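import Mathlib
import Summits.ValiantsHypothesis.ValiantsHypothesis.Theorems.BarrierLeverPartitionMinorsHitByVPHiddenStatesCoefficients
import Summits.ValiantsHypothesis.ValiantsHypothesis.Theorems.BarrierLeverPartitionMinorsHitByVPSimplexJoinDoor

/-!
# Route BarrierLever — item `PartitionMinorsHitByVP` (stmt-ValiantsHypothesis-19717):
# ROW-THRESHOLD ABSORPTION for the simplex-product join door — a piece absorbs every slice it is good on

Helper file (`--supports stmt-ValiantsHypothesis-19717`; cell valiant-natproofs, rung V4, 𝒟-side door (c), line
`hidden_states`; prover seat val-np-p3 gen 11). Definition-free. Closes NO item.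

THE PRINCIPLE (the Cauchy–Binet leading-term trick of `…HiddenStatesCoefficients`, transposed to ROWS). In the
exact-support door (`…SimplexJoinDoor`) the `u`-side matrix of a design is `N = [N_p]_p`, one column block per piece,
with independent tables. Scale the table of ONE piece `p₀` by the torus `z_a ↦ c^{w_a} z_a`: its columns pick up the
ROW factor `c^{wt i}`, `wt i = Σ_{a ∈ u i} w_a`, the other blocks are unchanged. If the rows of weight below a
threshold (`R`, `|R| = #columns of p₀`) give a nonsingular block `N[R, p₀]` for some table of `p₀`, and the other rows
give a nonsingular block `N[Rᶜ, other pieces]` for some tables of the other pieces, then the coefficient of `c^{wt(R)}`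
in `det N(c)` is `± det N[R, p₀] · det N[Rᶜ, rest] ≠ 0` (every other transversal of the `p₀`-columns is strictly
heavier, `HiddenStates.sum_lt_sum_of_threshold`), so some numeric `c` makes the whole design good:

* `coeff_det_rowScaled` — the leading coefficient (Leibniz + the threshold lemma); `det_blockZero_ne_zero` (the block
  determinant); `exists_rowScale_det_ne_zero` (matrix form of the principle);
* `elim_mul`, `prod_scaled_point` — bookkeeping for the scaled table;
* **`good_of_absorb`** — THE ABSORPTION THEOREM for the door's `u`-side hypothesis: `GOOD(R, piece p₀) ∧
  GOOD(Rᶜ, other pieces) ⇒ GOOD(all rows, design)` whenever `R` is a `w`-threshold slice of the rows (any `w : Fin h → ℕ`).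

WHY IT MATTERS (seat memo): with `w` concentrated on one coordinate the slices are `{i : a ∈ u i}` / `{i : a ∉ u i}`; with
`w` rewarding a set `C` and forbidding `[h] ∖ (C ∪ B)` the slice is the interval `[C, C ∪ B] ∩ u`; simplices absorb any slice
of their size. Iterating gives PEELING certificates (order of pieces + weights); in the seat's experiments (h ≤ 6, digit-join
designs, numeric single-piece oracle) every GOOD instance had one. WHAT THIS IS NOT: single-piece goodness is an input, not
proved here; item 19717 stays OPEN; nothing on crux 14610 or VP ≠ VNP.
-/

set_option linter.dupNamespace false

namespace Summit.ValiantsHypothesis.ValiantsHypothesis.Theorems.BarrierLever.SimplexJoin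

open Finset Matrix
open Summit.ValiantsHypothesis.ValiantsHypothesis.Theorems.BarrierLever.HiddenStates (sum_lt_sum_of_threshold)

noncomputable section

/-! ## 1. A coefficient lemma: row-scaling one column block -/

section Matrix

variable {r : ℕ}

/-- **Leading coefficient under a row-threshold.** Let `N : Matrix (Fin r) (Fin r) ℂ`, `P ⊆ Fin r` a set of columns,
`wt : Fin r → ℕ` row weights and `R` a set of rows with `|R| = |P|` such that every row outside `R` is strictly heavier
than every row inside. Scale the `P`-columns by the row factor `X^{wt i}`. Then the coefficient of `X^{Σ_{i∈R} wt i}` in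
the determinant is the determinant of the matrix `N⁰` obtained by zeroing the blocks `R × Pᶜ` and `Rᶜ × P`. -/
theorem coeff_det_rowScaled (N : Matrix (Fin r) (Fin r) ℂ) (P R : Finset (Fin r)) (wt : Fin r → ℕ)
    (hcard : R.card = P.card) (hthr : ∀ i ∈ R, ∀ i' ∉ R, wt i < wt i') :
    ((Matrix.of fun i k : Fin r =>
        if k ∈ P then Polynomial.C (N i k) * Polynomial.X ^ wt i else Polynomial.C (N i k)).det).coeff
        (∑ i ∈ R, wt i) =
      (Matrix.of fun i k : Fin r => if (i ∈ R ↔ k ∈ P) then N i k else 0).det := by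
  classical
  rw [Matrix.det_apply', Matrix.det_apply', Polynomial.finsetSum_coeff]
  refine Finset.sum_congr rfl fun σ _ => ?_
  -- the `σ`-term of the scaled matrix is `sign σ · (∏_k N (σ k) k) · X^{Σ_{k∈P} wt (σ k)}`
  have hterm : (∏ k : Fin r, (Matrix.of fun i k : Fin r =>
      if k ∈ P then Polynomial.C (N i k) * Polynomial.X ^ wt i else Polynomial.C (N i k)) (σ k) k) =
      Polynomial.C (∏ k : Fin r, N (σ k) k) * Polynomial.X ^ (∑ k ∈ P, wt (σ k)) := by
    simp only [Matrix.of_apply]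
    rw [← Finset.prod_filter_mul_prod_filter_not Finset.univ (fun k => k ∈ P)]
    have hfP : Finset.univ.filter (fun k : Fin r => k ∈ P) = P := by ext k; simp
    have h1 : ∏ k ∈ Finset.univ.filter (fun k : Fin r => k ∈ P),
        (if k ∈ P then Polynomial.C (N (σ k) k) * Polynomial.X ^ wt (σ k) else Polynomial.C (N (σ k) k)) =
        ∏ k ∈ P, Polynomial.C (N (σ k) k) * Polynomial.X ^ wt (σ k) := by
      rw [hfP]
      exact Finset.prod_congr rfl fun k hk => by rw [if_pos hk]
    have h2 : ∏ k ∈ Finset.univ.filter (fun k : Fin r => ¬ k ∈ P),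
        (if k ∈ P then Polynomial.C (N (σ k) k) * Polynomial.X ^ wt (σ k) else Polynomial.C (N (σ k) k)) =
        ∏ k ∈ Finset.univ.filter (fun k : Fin r => ¬ k ∈ P), Polynomial.C (N (σ k) k) := by
      refine Finset.prod_congr rfl fun k hk => ?_
      rw [Finset.mem_filter] at hk
      rw [if_neg hk.2]
    rw [h1, h2, Finset.prod_mul_distrib, Finset.prod_pow_eq_pow_sum, ← map_prod Polynomial.C,
      ← map_prod Polynomial.C]
    have h3 : (∏ k : Fin r, N (σ k) k) = (∏ k ∈ P, N (σ k) k) *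
        ∏ k ∈ Finset.univ.filter (fun k : Fin r => ¬ k ∈ P), N (σ k) k := by
      rw [← Finset.prod_filter_mul_prod_filter_not Finset.univ (fun k : Fin r => k ∈ P), hfP]
    rw [h3, map_mul]
    ring
  rw [hterm]
  -- coefficient extraction
  have hsign : (((Equiv.Perm.sign σ : ℤˣ) : ℤ) : Polynomial ℂ) =
      Polynomial.C ((((Equiv.Perm.sign σ : ℤˣ) : ℤ) : ℂ)) := by simp
  rw [hsign, ← mul_assoc, ← map_mul, Polynomial.coeff_C_mul_X_pow]
  -- case analysis: does `σ` map the `P`-columns exactly onto the `R`-rows?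
  by_cases hmatch : ∀ k, (σ k ∈ R ↔ k ∈ P)
  · -- weights agree and no zeroed entry is hit
    have hsum : ∑ k ∈ P, wt (σ k) = ∑ i ∈ R, wt i := by
      rw [← Finset.sum_image (f := wt) (s := P) (g := fun k => σ k) (fun k _ k' _ hk => σ.injective hk)]
      congr 1
      ext i
      simp only [Finset.mem_image]
      constructor
      · rintro ⟨k, hk, rfl⟩; exact (hmatch k).mpr hk
      · intro hi; exact ⟨σ.symm i, (hmatch _).mp (by simpa using hi), by simp⟩
    rw [if_pos hsum.symm]
    congr 1
    refine Finset.prod_congr rfl fun k _ => ?_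
    rw [Matrix.of_apply, if_pos (hmatch k)]
  · -- some `P`-column goes outside `R`, so the `N⁰`-product vanishes and the weight is wrong
    have hzero : (∏ k : Fin r, (Matrix.of fun i k : Fin r => if (i ∈ R ↔ k ∈ P) then N i k else 0) (σ k) k) = 0 := by
      obtain ⟨k, hk⟩ := not_forall.mp hmatch
      exact Finset.prod_eq_zero (Finset.mem_univ k) (by rw [Matrix.of_apply, if_neg hk])
    rw [hzero, mul_zero]
    -- it remains to see that the weights differ: there is a `P`-column sent outside `R`
    have hex : ∃ k ∈ P, σ k ∉ R := by
      by_contra hcon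
      push Not at hcon
      have hsub : P.image σ ⊆ R := by
        intro i hi
        obtain ⟨k, hk, rfl⟩ := Finset.mem_image.mp hi
        exact hcon k hk
      have heq : P.image σ = R := Finset.eq_of_subset_of_card_le hsub
        (by rw [hcard, Finset.card_image_of_injective _ σ.injective])
      apply hmatch
      intro k
      constructor
      · intro hk
        rw [← heq] at hk
        obtain ⟨k', hk', hkk'⟩ := Finset.mem_image.mp hk
        rwa [← σ.injective hkk']
      · intro hk
        rw [← heq]
        exact Finset.mem_image_of_mem σ hk
    suffices hne : (∑ i ∈ R, wt i) ≠ ∑ k ∈ P, wt (σ k) by rw [if_neg hne]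
    intro hEq
    obtain ⟨k₀, hk₀P, hk₀R⟩ := hex
    -- enumerate `R` and `P` by `Fin n` and apply the threshold lemma to the injective selection `σ ∘ (enum P)`
    set n := P.card with hn
    have eR : R ≃ Fin n := R.equivFinOfCardEq hcard
    have eP : P ≃ Fin n := P.equivFinOfCardEq rfl
    set fe : Fin n → Fin r := fun x => ((eR.symm x : R) : Fin r) with hfe
    set fp : Fin n → Fin r := fun x => σ ((eP.symm x : P) : Fin r) with hfp
    have hfe_inj : Function.Injective fe := fun x y hxy => by
      apply eR.symm.injective; exact Subtype.ext hxy
    have hfp_inj : Function.Injective fp := fun x y hxy => by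
      apply eP.symm.injective; exact Subtype.ext (σ.injective hxy)
    have hrange_e : ∀ i, i ∈ Set.range fe ↔ i ∈ R := by
      intro i; constructor
      · rintro ⟨x, rfl⟩; exact (eR.symm x).2
      · intro hi; exact ⟨eR ⟨i, hi⟩, by simp [hfe]⟩
    have hthr' : ∀ k, k ∉ Set.range fe → ∀ x, wt (fe x) < wt k := by
      intro k hk x
      exact hthr _ ((hrange_e _).mp ⟨x, rfl⟩) _ (fun hkR => hk ((hrange_e k).mpr hkR))
    have hne : fp ∉ (Finset.univ : Finset (Equiv.Perm (Fin n))).image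
        (fun τ : Equiv.Perm (Fin n) => fe ∘ (τ : Fin n → Fin n)) := by
      intro hmem
      obtain ⟨τ, -, hτ⟩ := Finset.mem_image.mp hmem
      have : σ k₀ ∈ R := by
        have h1 : fp (eP ⟨k₀, hk₀P⟩) = σ k₀ := by simp [hfp]
        rw [← h1, ← hτ, Function.comp_apply]
        exact (hrange_e _).mp ⟨_, rfl⟩
      exact hk₀R this
    have hlt := sum_lt_sum_of_threshold wt fe fp hfe_inj hfp_inj hthr' hne
    -- translate the two sums
    have hsumR : ∑ x, wt (fe x) = ∑ i ∈ R, wt i := by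
      rw [← Finset.sum_coe_sort R]
      exact Fintype.sum_equiv eR.symm (fun x => wt (fe x)) (fun i => wt i) (fun x => rfl)
    have hsumP : ∑ x, wt (fp x) = ∑ k ∈ P, wt (σ k) := by
      rw [← Finset.sum_coe_sort P]
      exact Fintype.sum_equiv eP.symm (fun x => wt (fp x)) (fun k => wt (σ k)) (fun x => rfl)
    rw [hsumR, hsumP] at hlt
    exact hlt.ne hEq

/-- **Block form of `N⁰`.** If the rows split by `er : Fin n ⊕ Fin n' ≃ Fin r` (left part = `R`) and the columns by
`ec` (left part = `P`), then `det N⁰ ≠ 0` as soon as the two diagonal blocks are nonsingular. -/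
theorem det_blockZero_ne_zero {n n' : ℕ} (N : Matrix (Fin r) (Fin r) ℂ) (P R : Finset (Fin r))
    (er ec : Fin n ⊕ Fin n' ≃ Fin r)
    (hR : ∀ i, i ∈ R ↔ ∃ x, er (Sum.inl x) = i) (hP : ∀ k, k ∈ P ↔ ∃ x, ec (Sum.inl x) = k)
    (hA : (Matrix.of fun x x' : Fin n => N (er (Sum.inl x)) (ec (Sum.inl x'))).det ≠ 0)
    (hD : (Matrix.of fun y y' : Fin n' => N (er (Sum.inr y)) (ec (Sum.inr y'))).det ≠ 0) :
    (Matrix.of fun i k : Fin r => if (i ∈ R ↔ k ∈ P) then N i k else 0).det ≠ 0 := by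
  classical
  set N0 : Matrix (Fin r) (Fin r) ℂ := Matrix.of fun i k : Fin r => if (i ∈ R ↔ k ∈ P) then N i k else 0 with hN0
  have hRl : ∀ x, er (Sum.inl x) ∈ R := fun x => (hR _).mpr ⟨x, rfl⟩
  have hRr : ∀ y, er (Sum.inr y) ∉ R := fun y hy => by
    obtain ⟨x, hx⟩ := (hR _).mp hy
    exact absurd (er.injective hx) Sum.inl_ne_inr
  have hPl : ∀ x, ec (Sum.inl x) ∈ P := fun x => (hP _).mpr ⟨x, rfl⟩
  have hPr : ∀ y, ec (Sum.inr y) ∉ P := fun y hy => by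
    obtain ⟨x, hx⟩ := (hP _).mp hy
    exact absurd (ec.injective hx) Sum.inl_ne_inr
  have hblock : N0.submatrix er ec = Matrix.fromBlocks
      (Matrix.of fun x x' : Fin n => N (er (Sum.inl x)) (ec (Sum.inl x'))) 0 0
      (Matrix.of fun y y' : Fin n' => N (er (Sum.inr y)) (ec (Sum.inr y'))) := by
    refine Matrix.ext fun s s' => ?_
    rcases s with x | y <;> rcases s' with x' | y' <;>
      simp [hN0, Matrix.submatrix_apply, Matrix.fromBlocks, hRl, hRr, hPl, hPr]
  have hperm : N0.submatrix er ec = (N0.submatrix er er).submatrix id (ec.trans er.symm) := by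
    refine Matrix.ext fun s s' => ?_
    simp [Matrix.submatrix_apply]
  have hdet : (N0.submatrix er ec).det = Equiv.Perm.sign (ec.trans er.symm) * N0.det := by
    rw [hperm, Matrix.det_permute', Matrix.det_submatrix_equiv_self]
  intro h0
  have : (N0.submatrix er ec).det = 0 := by rw [hdet, h0, mul_zero]
  rw [hblock, Matrix.det_fromBlocks_zero₂₁] at this
  exact mul_ne_zero hA hD this

/-- **Row-threshold lemma (matrix form).** Under the hypotheses of `coeff_det_rowScaled` and `det_blockZero_ne_zero`
some numeric scaling `c` of the `P`-columns by the row factors `c^{wt i}` makes `N` nonsingular. -/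
theorem exists_rowScale_det_ne_zero {n n' : ℕ} (N : Matrix (Fin r) (Fin r) ℂ) (P R : Finset (Fin r))
    (wt : Fin r → ℕ) (er ec : Fin n ⊕ Fin n' ≃ Fin r)
    (hR : ∀ i, i ∈ R ↔ ∃ x, er (Sum.inl x) = i) (hP : ∀ k, k ∈ P ↔ ∃ x, ec (Sum.inl x) = k)
    (hthr : ∀ i ∈ R, ∀ i' ∉ R, wt i < wt i')
    (hA : (Matrix.of fun x x' : Fin n => N (er (Sum.inl x)) (ec (Sum.inl x'))).det ≠ 0)
    (hD : (Matrix.of fun y y' : Fin n' => N (er (Sum.inr y)) (ec (Sum.inr y'))).det ≠ 0) :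
    ∃ c : ℂ, (Matrix.of fun i k : Fin r => if k ∈ P then c ^ wt i * N i k else N i k).det ≠ 0 := by
  classical
  have hcard : R.card = P.card := by
    have h1 : R = Finset.univ.image (fun x : Fin n => er (Sum.inl x)) := by
      ext i; simp only [Finset.mem_image, Finset.mem_univ, true_and]; exact hR i
    have h2 : P = Finset.univ.image (fun x : Fin n => ec (Sum.inl x)) := by
      ext k; simp only [Finset.mem_image, Finset.mem_univ, true_and]; exact hP k
    rw [h1, h2, Finset.card_image_of_injective _ (fun x y hxy => Sum.inl_injective (er.injective hxy)),
      Finset.card_image_of_injective _ (fun x y hxy => Sum.inl_injective (ec.injective hxy))]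
  set M : Matrix (Fin r) (Fin r) (Polynomial ℂ) := Matrix.of fun i k : Fin r =>
    if k ∈ P then Polynomial.C (N i k) * Polynomial.X ^ wt i else Polynomial.C (N i k) with hM
  have hdet : M.det ≠ 0 := by
    intro h0
    have hc := coeff_det_rowScaled N P R wt hcard hthr
    rw [← hM, h0, Polynomial.coeff_zero] at hc
    exact det_blockZero_ne_zero N P R er ec hR hP hA hD hc.symm
  by_contra hall
  push Not at hall
  apply hdet
  refine Polynomial.funext fun c => ?_
  rw [Polynomial.eval_zero]
  have hev : (M.det).eval c = (Matrix.of fun i k : Fin r => if k ∈ P then c ^ wt i * N i k else N i k).det := by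
    rw [← Polynomial.coe_evalRingHom, RingHom.map_det, RingHom.mapMatrix_apply]
    congr 1
    refine Matrix.ext fun i k => ?_
    simp only [hM, Matrix.map_apply, Matrix.of_apply, Polynomial.coe_evalRingHom]
    split_ifs with hk
    · rw [Polynomial.eval_mul, Polynomial.eval_C, Polynomial.eval_pow, Polynomial.eval_X, mul_comm]
    · rw [Polynomial.eval_C]
  rw [hev]
  exact hall c

end Matrix

/-! ## 2. The absorption theorem for the simplex-product join door -/

variable {h : ℕ}

/-- `Option.elim` commutes with a scalar factor inside. -/
theorem elim_mul {N : ℕ} (o : Option (Fin N)) (c : ℂ) (g : Fin N → ℂ) :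
    (o.elim (0 : ℂ) fun j => c * g j) = c * o.elim 0 g := by
  cases o <;> simp [Option.elim]

/-- The design point of a column under the table of its piece scaled by `c^{w a}` in coordinate `a`. -/
theorem prod_scaled_point {D N : ℕ} (t : Option (Fin D × Fin N) → Fin h → ℂ) (g : Fin D → Option (Fin N))
    (w : Fin h → ℕ) (c : ℂ) (U : Finset (Fin h)) :
    ∏ a ∈ U, (c ^ w a * t none a + ∑ f : Fin D, (g f).elim 0 fun j => c ^ w a * t (some (f, j)) a) =
      c ^ (∑ a ∈ U, w a) * ∏ a ∈ U, (t none a + ∑ f : Fin D, (g f).elim 0 fun j => t (some (f, j)) a) := by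
  rw [← Finset.prod_pow_eq_pow_sum, ← Finset.prod_mul_distrib]
  refine Finset.prod_congr rfl fun a _ => ?_
  rw [mul_add, Finset.mul_sum]
  congr 1
  refine Finset.sum_congr rfl fun f _ => ?_
  rw [elim_mul]

/-- **THE ABSORPTION THEOREM (simplex-product join door, `u`-side).** Fix a design `e : Fin r → Fin m × (Fin D → Option (Fin N))`
and a piece `p₀`; split the columns by `ec : Fin n ⊕ Fin n' ≃ Fin r` into the columns of `p₀` (left) and the others
(right), and the rows by `er` into a `w`-THRESHOLD SLICE (left: every left row is strictly `w`-lighter than every right row,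
weight `Σ_{a ∈ u i} w a`) and its complement. If SOME table makes the block (left rows × columns of `p₀`) nonsingular and
SOME table makes the block (right rows × other columns) nonsingular, then SOME table makes the whole `u`-side matrix of
the door nonsingular. (Scale `p₀`'s table by `c^{w a}` and take the leading coefficient in `c`.) -/
theorem good_of_absorb (h m D N r : ℕ) {n n' : ℕ} (u : Fin r → Finset (Fin h))
    (e : Fin r → Fin m × (Fin D → Option (Fin N))) (p₀ : Fin m) (w : Fin h → ℕ)
    (er ec : Fin n ⊕ Fin n' ≃ Fin r)
    (hPl : ∀ x, (e (ec (Sum.inl x))).1 = p₀) (hPr : ∀ y, (e (ec (Sum.inr y))).1 ≠ p₀)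
    (hthr : ∀ x y, ∑ a ∈ u (er (Sum.inl x)), w a < ∑ a ∈ u (er (Sum.inr y)), w a)
    (tx tx' : Fin m → Option (Fin D × Fin N) → Fin h → ℂ)
    (hA : (Matrix.of fun x x' : Fin n => ∏ a ∈ u (er (Sum.inl x)),
      (tx (e (ec (Sum.inl x'))).1 none a +
        ∑ f : Fin D, ((e (ec (Sum.inl x'))).2 f).elim 0 fun j => tx (e (ec (Sum.inl x'))).1 (some (f, j)) a)).det ≠ 0)
    (hB : (Matrix.of fun y y' : Fin n' => ∏ a ∈ u (er (Sum.inr y)),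
      (tx' (e (ec (Sum.inr y'))).1 none a +
        ∑ f : Fin D, ((e (ec (Sum.inr y'))).2 f).elim 0 fun j => tx' (e (ec (Sum.inr y'))).1 (some (f, j)) a)).det ≠ 0) :
    ∃ T : Fin m → Option (Fin D × Fin N) → Fin h → ℂ,
      (Matrix.of fun i k : Fin r => ∏ a ∈ u i,
        (T (e k).1 none a + ∑ f : Fin D, ((e k).2 f).elim 0 fun j => T (e k).1 (some (f, j)) a)).det ≠ 0 := by
  classical
  -- the combined unscaled table: `p₀` from `tx`, the other pieces from `tx'`
  set T0 : Fin m → Option (Fin D × Fin N) → Fin h → ℂ :=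
    fun p o a => if p = p₀ then tx p o a else tx' p o a with hT0
  set Tc : ℂ → Fin m → Option (Fin D × Fin N) → Fin h → ℂ :=
    fun c p o a => if p = p₀ then c ^ w a * tx p o a else tx' p o a with hTc
  set N0 : Matrix (Fin r) (Fin r) ℂ := Matrix.of fun i k : Fin r => ∏ a ∈ u i,
    (T0 (e k).1 none a + ∑ f : Fin D, ((e k).2 f).elim 0 fun j => T0 (e k).1 (some (f, j)) a) with hN0
  set P : Finset (Fin r) := Finset.univ.filter fun k => (e k).1 = p₀ with hPdef
  set R : Finset (Fin r) := Finset.univ.image fun x : Fin n => er (Sum.inl x) with hRdef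
  set wt : Fin r → ℕ := fun i => ∑ a ∈ u i, w a with hwt
  have hR : ∀ i, i ∈ R ↔ ∃ x, er (Sum.inl x) = i := by
    intro i; simp [hRdef]
  have hP : ∀ k, k ∈ P ↔ ∃ x, ec (Sum.inl x) = k := by
    intro k
    rw [hPdef, Finset.mem_filter]
    simp only [Finset.mem_univ, true_and]
    constructor
    · intro hk
      rcases hsk : ec.symm k with x | y
      · exact ⟨x, by rw [← hsk, Equiv.apply_symm_apply]⟩
      · exfalso
        apply hPr y
        have : ec (Sum.inr y) = k := by rw [← hsk, Equiv.apply_symm_apply]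
        rw [this]; exact hk
    · rintro ⟨x, rfl⟩; exact hPl x
  have hthr' : ∀ i ∈ R, ∀ i' ∉ R, wt i < wt i' := by
    intro i hi i' hi'
    obtain ⟨x, rfl⟩ := (hR i).mp hi
    rcases hsi : er.symm i' with x' | y
    · exact absurd ((hR i').mpr ⟨x', by rw [← hsi, Equiv.apply_symm_apply]⟩) hi'
    · have : i' = er (Sum.inr y) := by rw [← hsi, Equiv.apply_symm_apply]
      rw [this]; exact hthr x y
  -- the two diagonal blocks of `N0` are the hypothesis matrices
  have hA' : (Matrix.of fun x x' : Fin n => N0 (er (Sum.inl x)) (ec (Sum.inl x'))).det ≠ 0 := by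
    have hmat : (Matrix.of fun x x' : Fin n => N0 (er (Sum.inl x)) (ec (Sum.inl x'))) =
        Matrix.of fun x x' : Fin n => ∏ a ∈ u (er (Sum.inl x)),
          (tx (e (ec (Sum.inl x'))).1 none a +
            ∑ f : Fin D, ((e (ec (Sum.inl x'))).2 f).elim 0 fun j => tx (e (ec (Sum.inl x'))).1 (some (f, j)) a) := by
      refine Matrix.ext fun x x' => ?_
      simp only [Matrix.of_apply, hN0, hT0, hPl, if_true]
    rw [hmat]; exact hA
  have hB' : (Matrix.of fun y y' : Fin n' => N0 (er (Sum.inr y)) (ec (Sum.inr y'))).det ≠ 0 := by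
    have hmat : (Matrix.of fun y y' : Fin n' => N0 (er (Sum.inr y)) (ec (Sum.inr y'))) =
        Matrix.of fun y y' : Fin n' => ∏ a ∈ u (er (Sum.inr y)),
          (tx' (e (ec (Sum.inr y'))).1 none a +
            ∑ f : Fin D, ((e (ec (Sum.inr y'))).2 f).elim 0 fun j => tx' (e (ec (Sum.inr y'))).1 (some (f, j)) a) := by
      refine Matrix.ext fun y y' => ?_
      simp only [Matrix.of_apply, hN0, hT0, hPr, if_false]
    rw [hmat]; exact hB
  obtain ⟨c, hc⟩ := exists_rowScale_det_ne_zero N0 P R wt er ec hR hP hthr' hA' hB'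
  refine ⟨Tc c, ?_⟩
  -- the door matrix of the scaled combined table is the row-scaled `N0`
  have hmat : (Matrix.of fun i k : Fin r => ∏ a ∈ u i,
      (Tc c (e k).1 none a + ∑ f : Fin D, ((e k).2 f).elim 0 fun j => Tc c (e k).1 (some (f, j)) a)) =
      Matrix.of fun i k : Fin r => if k ∈ P then c ^ wt i * N0 i k else N0 i k := by
    refine Matrix.ext fun i k => ?_
    by_cases hk : (e k).1 = p₀
    · have hkP : k ∈ P := by rw [hPdef, Finset.mem_filter]; exact ⟨Finset.mem_univ _, hk⟩
      simp only [Matrix.of_apply, hN0, hTc, hT0, hk, if_true, hkP, hwt]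
      exact prod_scaled_point (tx p₀) (e k).2 w c (u i)
    · have hkP : k ∉ P := by rw [hPdef, Finset.mem_filter]; exact fun hh => hk hh.2
      simp only [Matrix.of_apply, hN0, hTc, hT0, hk, if_false, hkP]
  rw [hmat]
  exact hc

end

end Summit.ValiantsHypothesis.ValiantsHypothesis.Theorems.BarrierLever.SimplexJoin
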